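import Mathlib

/-!
# Product frames for six products (stub `stub_productFrame`)

Line `singlet-fraction-transfer` for the crux `FidelityWitnesses.SevenEighthsLaw`
(`stmt-MatrixMultiplication-4959`, `M(2,6) = 7`).

In the `16`-dimensional space of functions `(Fin 2 × Fin 2) → (Fin 2 × Fin 2) → ℂ` with the
Hermitian product `⟨f, g⟩ = Σ_b Σ_c conj (f b c) * g b c`, ANY six product vectors
`(b, c) ↦ u l b * v l c` (`l : Fin 6`, possibly dependent, possibly zero) lie in the span of an
orthonormal `6`-frame `e` which is itself spanned by six products `u' l ⊗ v' l`.

Proof: the `16` standard products `δ_b ⊗ δ_c` form a basis, so (exchange lemma,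
`exists_linearIndepOn_extension`) a maximal linearly independent subfamily of the `u l ⊗ v l`
extends by standard products to a basis consisting of products; choose `6` of its members
containing that subfamily and apply Gram–Schmidt (`gramSchmidtNormed`) in
`EuclideanSpace ℂ ((Fin 2 × Fin 2) × (Fin 2 × Fin 2))`, whose inner product is exactly the
Hermitian product above.
-/

-- the tree's namespace `Summit.MatrixMultiplication.MatrixMultiplication.…` repeats a component by design
set_option linter.dupNamespace false

namespace Summit.MatrixMultiplication.MatrixMultiplication.Theorems.SevenEighthsLaw

open scoped BigOperators ComplexConjugate
open InnerProductSpace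

/-- Exchange/padding lemma: if the family `w` spans the space, then any index set `A` with at
most `n ≤ finrank` elements is captured by the span of `w` on some `n`-element index set `C` on
which `w` is linearly independent. -/
private theorem exists_linearIndepOn_ncard_eq {K E ι : Type*} [Field K] [AddCommGroup E]
    [Module K E] [Finite ι] (w : ι → E) (A : Set ι) (n : ℕ)
    (hA : A.ncard ≤ n) (hn : n ≤ Module.finrank K E)
    (hw : ⊤ ≤ Submodule.span K (Set.range w)) :
    ∃ C : Set ι, C.ncard = n ∧ LinearIndepOn K w C ∧ w '' A ⊆ Submodule.span K (w '' C) := by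
  obtain ⟨s₀, hs₀A, -, hAs₀, hs₀li⟩ :=
    exists_linearIndepOn_extension (linearIndepOn_empty K w) (Set.empty_subset A)
  obtain ⟨B, -, hs₀B, hB, hBli⟩ := exists_linearIndepOn_extension hs₀li (Set.subset_univ s₀)
  have hs₀n : s₀.ncard ≤ n := (Set.ncard_le_ncard hs₀A).trans hA
  have hBspan : ⊤ ≤ Submodule.span K (Set.range fun x : B => w x) := by
    rw [← Set.image_eq_range]
    refine hw.trans (Submodule.span_le.mpr ?_)
    rw [← Set.image_univ]
    exact hB
  have hcard : Module.finrank K E = B.ncard := by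
    rw [Module.finrank_eq_nat_card_basis (Module.Basis.mk hBli.linearIndependent hBspan),
      Nat.card_coe_set_eq]
  obtain ⟨C, hs₀C, hCB, hC⟩ := Set.exists_subsuperset_card_eq hs₀B hs₀n (hcard ▸ hn)
  exact ⟨C, hC, hBli.mono hCB, hAs₀.trans (Submodule.span_mono (Set.image_mono hs₀C))⟩

/-- **Product frame.** For any six products `u l ⊗ v l` in
`(Fin 2 × Fin 2) → (Fin 2 × Fin 2) → ℂ` there are six products `u' l ⊗ v' l` and an orthonormal
(for `⟨f, g⟩ = Σ_b Σ_c conj (f b c) * g b c`) `6`-frame `e` with every `e s` in the span of the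
`u' l ⊗ v' l` and every `u l ⊗ v l` in the span of `e`. -/
theorem stub_productFrame (u v : Fin 6 → (Fin 2 × Fin 2) → ℂ) :
    ∃ (u' v' : Fin 6 → (Fin 2 × Fin 2) → ℂ) (e : Fin 6 → (Fin 2 × Fin 2) → (Fin 2 × Fin 2) → ℂ),
      (∀ s t : Fin 6, (∑ b, ∑ c, conj (e s b c) * e t b c) = if s = t then 1 else 0) ∧
      (∀ s, e s ∈ Submodule.span ℂ (Set.range fun l : Fin 6 => fun b c => u' l b * v' l c)) ∧
      ∀ l : Fin 6, (fun b c => u l b * v l c) ∈ Submodule.span ℂ (Set.range e) := by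
  classical
  -- factor families indexed by `Fin 6 ⊕ (P2 × P2)`: the six given products, then the standard ones
  let X : Fin 6 ⊕ (Fin 2 × Fin 2) × (Fin 2 × Fin 2) → (Fin 2 × Fin 2) → ℂ :=
    Sum.elim u fun bc b => if b = bc.1 then 1 else 0
  let Y : Fin 6 ⊕ (Fin 2 × Fin 2) × (Fin 2 × Fin 2) → (Fin 2 × Fin 2) → ℂ :=
    Sum.elim v fun bc c => if c = bc.2 then 1 else 0
  -- the products, as vectors of the Euclidean space on `P2 × P2`
  let w : Fin 6 ⊕ (Fin 2 × Fin 2) × (Fin 2 × Fin 2) →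
      EuclideanSpace ℂ ((Fin 2 × Fin 2) × (Fin 2 × Fin 2)) :=
    fun i => WithLp.toLp 2 fun bc => X i bc.1 * Y i bc.2
  -- back to curried functions (a linear map)
  let ψ : EuclideanSpace ℂ ((Fin 2 × Fin 2) × (Fin 2 × Fin 2)) →ₗ[ℂ]
      (Fin 2 × Fin 2) → (Fin 2 × Fin 2) → ℂ :=
    { toFun := fun x b c => x (b, c)
      map_add' := fun _ _ => rfl
      map_smul' := fun _ _ => rfl }
  -- the standard products are the standard basis vectors
  have hstd : ∀ bc, w (Sum.inr bc) = EuclideanSpace.single bc 1 := by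
    rintro ⟨b, c⟩
    ext ⟨b', c'⟩
    simp only [w, X, Y, Sum.elim_inr, PiLp.single_apply, Prod.mk.injEq]
    by_cases h1 : b' = b <;> by_cases h2 : c' = c <;> simp [h1, h2]
  have hw : ⊤ ≤ Submodule.span ℂ (Set.range w) := by
    rw [← (PiLp.basisFun 2 ℂ ((Fin 2 × Fin 2) × (Fin 2 × Fin 2))).span_eq]
    refine Submodule.span_mono ?_
    rintro _ ⟨bc, rfl⟩
    exact ⟨Sum.inr bc, by rw [PiLp.basisFun_apply]; exact hstd bc⟩
  have hA : (Set.range (Sum.inl : Fin 6 → Fin 6 ⊕ (Fin 2 × Fin 2) × (Fin 2 × Fin 2))).ncard ≤ 6 := by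
    rw [Set.ncard_range_of_injective Sum.inl_injective]
    simp
  have h6 : 6 ≤ Module.finrank ℂ (EuclideanSpace ℂ ((Fin 2 × Fin 2) × (Fin 2 × Fin 2))) := by
    simp
  obtain ⟨C, hC, hCli, hAC⟩ := exists_linearIndepOn_ncard_eq w (Set.range Sum.inl) 6 hA h6 hw
  -- enumerate `C` by `Fin 6`
  have hCcard : Nat.card C = 6 := by rw [Nat.card_coe_set_eq, hC]
  let σ : Fin 6 ≃ C := (Finite.equivFinOfCardEq hCcard).symm
  let p : Fin 6 → EuclideanSpace ℂ ((Fin 2 × Fin 2) × (Fin 2 × Fin 2)) := fun l => w (σ l)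
  have hpli : LinearIndependent ℂ p := hCli.linearIndependent.comp σ σ.injective
  have hpC : w '' C ⊆ Set.range p := by
    rintro _ ⟨i, hi, rfl⟩
    exact ⟨σ.symm ⟨i, hi⟩, by simp [p, σ]⟩
  -- Gram–Schmidt
  have he' : Orthonormal ℂ (gramSchmidtNormed ℂ p) := gramSchmidtNormed_orthonormal hpli
  have hspan : Submodule.span ℂ (Set.range (gramSchmidtNormed ℂ p)) =
      Submodule.span ℂ (Set.range p) := by
    rw [span_gramSchmidtNormed_range, span_gramSchmidt]
  have key : ∀ x y : EuclideanSpace ℂ ((Fin 2 × Fin 2) × (Fin 2 × Fin 2)),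
      (∑ b, ∑ c, conj (x (b, c)) * y (b, c)) = inner ℂ x y := by
    intro x y
    simp only [PiLp.inner_apply, RCLike.inner_apply]
    rw [Fintype.sum_prod_type (f := fun bc => y bc * conj (x bc))]
    exact Finset.sum_congr rfl fun b _ => Finset.sum_congr rfl fun c _ => mul_comm _ _
  refine ⟨fun l => X (σ l), fun l => Y (σ l), fun s b c => gramSchmidtNormed ℂ p s (b, c),
    ?_, ?_, ?_⟩
  · intro s t
    rw [← orthonormal_iff_ite.mp he' s t]
    exact key _ _
  · intro s
    have hs : gramSchmidtNormed ℂ p s ∈ Submodule.span ℂ (Set.range p) := by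
      rw [← hspan]
      exact Submodule.subset_span ⟨s, rfl⟩
    have := Submodule.apply_mem_span_image_of_mem_span ψ hs
    rw [← Set.range_comp] at this
    exact this
  · intro l
    have hl : w (Sum.inl l) ∈ Submodule.span ℂ (Set.range (gramSchmidtNormed ℂ p)) := by
      rw [hspan]
      exact Submodule.span_mono hpC (hAC ⟨Sum.inl l, ⟨l, rfl⟩, rfl⟩)
    have := Submodule.apply_mem_span_image_of_mem_span ψ hl
    rw [← Set.range_comp] at this
    exact this

end Summit.MatrixMultiplication.MatrixMultiplication.Theorems.SevenEighthsLaw
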